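import Summits.BirchSwinnertonDyer.Rank1Residual.F1Sign2.CasselsTateRadicalAtTwo
import HarnessLib

/-!
# Cell `bsd-f1-sign2` — descent lens (planner `-desc`, g9; MEMO-desc §17.9–§17.10): the MODEL ↔ `PrimeTwist` dictionary at `p = 2`
and the ∞-RELAXED `2`-Selmer group — the canonical, `d`-free description of the rigid twisted Selmer group on the up-branch

STATEMENTS + one DEFINITION WITH BODY + PROVED glue (three support rows as plain `def … : Prop` exactly as the planner's sketch has them —
`TwistModelDictionaryAtTwo` (REF1-AUDIT §41's recommended support row for U′ / B⁰ of `F1Sign2/CasselsTateRadicalAtTwo.lean`),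
`SelmerIndexInRelaxedAtInfinityAtTwo`, `TwistSelmerEqRelaxedAtInfinityAtTwo` (canonical `R`); the definition `selmerGroupRelaxedAtInfinityAtTwo W`
= the tree's `WeierstrassCurve.selmerGroup W 2` with the archimedean local condition dropped; the planner's glue `shaIndexTwo_of_relaxed` PROVED; three
definitional API lemmas on the new definition PROVED by the typer (`selmerGroup_le_selmerGroupRelaxedAtInfinityAtTwo`,
`mem_selmerGroupRelaxedAtInfinityAtTwo_iff`, `selmerGroupRelaxedAtInfinityAtTwo_inf_infinitePlaces`); nothing asserted, no named fact, no `sorry`).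

TYPER FILING (seat `bsd-f1-sign2-ty` g3; CANDIDATES.md rows DESC-§17-DICT / DESC-§17-REL / DESC-§17-IDX / DESC-§17-R): bodies VERBATIM from the planner's
`HOME/MEMO-desc-data/g9/Sketch-v10.lean` 5836a6cde822818d (-desc g9 2026-08-28T00:07:10Z; landed as p589546) with the docstring of `TwistSelmerEqRelaxedAtInfinityAtTwo` RE-SYNCED (text-only follow-up, -desc 00:19:34Z / 00:26:45Z ask) to the planner's corrected file 21363d52fa118bd2 = MEMO-desc §17.11 CORRECTION (memo 22edb6834d19c823 l.983–989; kit j294681 D18e / j294796 D18f / j295013 D18g): the withdrawn census sentence «up-branch 1 865/1 865 (rank 0, Ш[2] = (ℤ/2)²) …» — a twist-level count INSIDE the selected odd-branch classes, not a stratum law — replaced by the planner's stratum census (up iff `res_∞ Sel₂(W) = 0`; RARE when `Ш(W)[2] ≠ 0`: 513/15 382 = 3.34 %); all five BODIES byte-identical across 5836a6cde822818d / 21363d52fa118bd2 / this file (checked by script); O-∞ withdrawn by the planner, nothing typed depended on it; MEMO-desc.md 7882e9b57808e1dc §17.10 l.981, §17.9 ADDENDUM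
d6359947bb78042a l.972; `lean check` rc 0 / 0 err / 0 warn / 0 sorry per -desc and re-checked by the typer against the tree; data `MEMO-desc-data/g9/jobD18{,b,c}/`
+ SHA16SUMS-D18, kit j293607 / j293865 / j294440 / j294464); the only edits are this header, the `import HarnessLib` line and the three typer API lemmas
marked «typer addition» below (the sketch's own declarations are untouched and in the sketch's order). Port cut (the planner left it to the typer:
«append (i) to `CasselsTateRadicalAtTwo.lean`, (ii) as sibling … (or same file) — your cut»): ONE sibling file importing the landed
`F1Sign2/CasselsTateRadicalAtTwo.lean` and holding (i) + (ii) together — one audit instead of two, the landed radical file (REF1 §41 / REF2 v16 §24 slot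
reads) byte-untouched, and a consumer imports this one module to get U′/B⁰ AND their dictionary. Typer's search-first notes: the tree's
`WeierstrassCurve.selmerGroup W n` (`Literature/NumberTheory/EllipticCurves/Selmer.lean`) IS `(⨅ finite v, selmerLocalKer) ⊓ (⨅ infinite w, selmerLocalKer)`,
so the relaxed group below is literally its first factor (API lemma `selmerGroupRelaxedAtInfinityAtTwo_inf_infinitePlaces` = `rfl`) and `Sel₂(W) ≤ Sel^{rel ∞}`
is `inf_le_left` — the CONTENT of `SelmerIndexInRelaxedAtInfinityAtTwo` is the index bound; `PrimeTwist.selmerGroup W χ`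
(`Literature/NumberTheory/EllipticCurves/UnramifiedPrimeTwist.lean`, MR 2007 Def. 4.3) lives in the same `W.galH1Torsion 2`, so all three rows are
inclusions / equalities of `AddSubgroup`s of ONE group — no transport maps. Cite numbering: `MazurRubin2007` = Ann. of Math. 166 (2007) in the arXiv
math/0512085 numbering the tree's `UnramifiedPrimeTwist` uses (§3 = the twist `A_L`, Prop. 4.1 = `E[p] = A_L[𝔓]`); `MazurRubin2010` = Invent. Math. 181
(2010) §3 «Comparing Selmer groups», published numbering Def. 3.1 / Lemma 3.2 / Prop. 3.3 (= items «Definition 26 / Lemma 27 / Proposition 28» of the held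
arXiv:0904.3709 text, `paper:arxiv-0904.3709` p0008 L1–60, read by the typer: Def. 26 defines `𝒮_T ⊂ 𝒮^T` for «a finite set of places `T`» — archimedean
places allowed; Lemma 27 `dim 𝒮^T − dim 𝒮_T = Σ_{v ∈ T} dim H¹_f(K_v, E[2])` by Poitou–Tate; Prop. 28 requires «all real places `v` with `(Δ_E)_v > 0`»
to SPLIT in `F/K`, i.e. excludes exactly the case `T ∋ ∞` used here — the planner's «real-place case OURS, proof verbatim»); `Morgan2023KummerGeneric`
Lemma 16 [p0009 L33–43] as quoted in `CasselsTateRadicalAtTwo.lean`.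
REF1-AUDIT-v1 §47 (b44, audit file e613db1c40bf6ade / 1231 l., 2026-08-28T00:18:55Z; evidence `HOME/REF1-data/b44/`): Sketch-v10 as-is rc 0 / 0 warn / 0 sorry; **BC7 3/3 CLEAN** (`TwistModelDictionaryAtTwo` P1 11.3 s / P2 4.9 / P2h 2.0; `SelmerIndexInRelaxedAtInfinityAtTwo` P1 13.0 / P2 0.02; `TwistSelmerEqRelaxedAtInfinityAtTwo` P1 16.7 / P2 1.5 / P2h 1.5); guards kernel-checked: G1 `Sel₂ ≤ Sel^{rel ∞}` = `inf_le_left` (a GENUINE relaxation — the tree's `selmerGroup` carries the `∞` condition), G2 the equality clause is forced by counting (`AddSubgroup.eq_of_le_of_card_ge`), G3/G4 junk `d = 1` / `d = 0` refused; **3/3 SURVIVE as SUPPORT, THEOREM-GRADE** (transport along `A_χ ≅ W^{(d)}`; `π₀(W(ℝ))` index; `DescAdmissible` ⇒ finite local conditions agree: `d ≡ 1 (8)`, `(d/ℓ) = 1`, `a_q` odd ⇒ `H¹(ℚ_q, W[2]) = 0` — each load-bearing under mutation); cite note: arXiv:0904.3709 numbering Def 26 / Lemma 27 / Prop 28 (held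 p0008) vs published 3.1 / 3.2 / 3.3. «-ty g3: FILE AS DRAFTED (placement per -desc)».
REF2-PLACEMENT v16 §35 (5a425b78d950b2ae, 2026-08-28T00:15:43Z; Sketch-v10 placed): **DESC-§17-REL / DESC-§17-IDX = IN PRINT** — Mazur–Rubin 2010 Def. 3.1 («`T` a finite set of PLACES» — `∞` allowed [`paper:arxiv-0904.3709` p0008 L7]) + Lemma 3.2 (= held «Lemma 27», p0008 L33–52; «index 2 ⟺ res_∞ Sel₂(W) = 0» IS the Poitou–Tate orthogonal-complement sentence of its proof) with `dim H¹_f(ℝ, W[2]) = 1` (`Δ > 0`) / `0` (`Δ < 0`). **DESC-§17-R = IN-PRINT ASSEMBLY, theorem-grade corollary, NOT verbatim**: the real-place analogue of MR 2010 Prop. 3.3 — the case the printed proposition EXCLUDES (real places with `Δ > 0` must SPLIT, `T` = finite primes [p0008 L54 ff.]) — «proof verbatim» yes, statement printed no. Steps all printed: the finite local conditions coincide (MR 2010 §2 lemmas; `H¹(ℚ_q, W[2]) = 0` at `q ∣ d`); `S ≠ R` by Kramer 1981 parity (the real row of Klagsbrun–Mazur–Rubin 2013's table [arXiv:1111.2321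 p0017], unconditional — [cite: Kramer1981] [cite: KlagsbrunMazurRubin2013]) or by the Lagrangian count (`H¹(ℝ, W[2])` a hyperbolic plane with exactly two `q_∞`-isotropic lines `X = L_∞(W)`, `Y = L_∞(W^{(d)})`, both Lagrangian [KMR p0012 L3–5; Poonen–Rains 2012, [cite: PoonenRains2012]], `X ∩ Y` = the `N_{ℂ/ℝ}`-image `= 2W(ℝ)` ⇒ distinct; `Z = res_∞ Sel^{rel}` Lagrangian [KMR p0008 L1–12] ⇒ `Z ∈ {X, Y}`, `Z = Y ⟺ res_∞ S = 0 ⟺ R = Sel^{rel}`, `d`-free). **DESC-§17-DICT = definitional** (MR 2007 / MR 2010 twist formalism; the `Nonempty (≃+)` caveat is REF1's to weigh). §17.9 data (0/1 156 habitat; 28.01 % / 2.77 %; dim-4 64/64, 0 violations) = BC5 strengthening only; v16 §24 placement of (G) / U′ unchanged; the even-branch twin inherits §24.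
PARTITION: none moved; beyond-print theorem: no (support rows; the planner: «§17.9 = census + routine real-place case of MR10 §3»).
bears_on: `stmt-BirchSwinnertonDyer-19099` `RankOneAtTwo` (→ children 23715 / 23716), via U′ / B⁰ of `CasselsTateRadicalAtTwo.lean`.

LANDING NOTE (-ty g13, 2026-08-28T22:2xZ; text only, statements untouched): **DESC-§17-IDX `SelmerIndexInRelaxedAtInfinityAtTwo` IS NOW A TREE
THEOREM** — `Summit.BirchSwinnertonDyer.BirchSwinnertonDyer.Theorems.GenusKolyTransp.selmerIndexInRelaxedAtInfinityAtTwo_holds :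
SelmerIndexInRelaxedAtInfinityAtTwo` (gk2-p4 g14, p668051 ACCEPTED, commit bd0cd937c8b5, file
`Summits/BirchSwinnertonDyer/BirchSwinnertonDyer/Theorems/GenusKolyvaginAtTwoGenusPrimitiveSupplyAtTwoRelaxedAtInfinityIndex.lean`, std axioms):
`Sel₂(W) ≤ Sel^{rel ∞}₂(W)` with index `1` or `2` for EVERY `E/ℚ` — [cite: MazurRubin2010, Lemma 3.2] at `T = {∞}`: strict ≤ `Sel₂` ≤ relaxed,
`[relaxed : strict] = #𝓛_∞ ∈ {1, 2}` by gk2-p5's archimedean Kummer count, with the Poitou–Tate / Euler–Poincaré named facts DISCHARGED via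
`poitouTate_selmerStructure_duality_real_holds` + `forall_localEulerPoincareCharacteristic_adicCompletion`; plus the dictionary
`…GenusKolyTransp.selmerGroupRelaxedAtInfinityAtTwo_eq_kummerRelaxed : selmerGroupRelaxedAtInfinityAtTwo W = (X11b.KummerPT.kummerRelaxed W 2 {∞}).selmerGroup`.
Consumers: feed `(h : SelmerIndexInRelaxedAtInfinityAtTwo)` with `selmerIndexInRelaxedAtInfinityAtTwo_holds`.  THE ∞-SWITCH IS KERNEL TOO (gk2-p5 g14,
p669629 ACCEPTED, commit f2c6bd825c08, file `…/Theorems/GenusKolyvaginAtTwoGenusPrimitiveSupplyAtTwoArchimedeanRelaxedSwitchEgg.lean`, ns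
`Summit.BirchSwinnertonDyer.BirchSwinnertonDyer.Theorems.GenusKolyArch`, std axioms): `relIndex_selmerGroup_selmerGroupRelaxedAtInfinityAtTwo_eq_one_of_meetsEgg`
(EVERY elliptic `W`: a rational egg point ⇒ index `1`; `selmerGroupRelaxedAtInfinityAtTwo_eq_selmerGroup_of_meetsEgg`: `R = Sel₂`),
`…_eq_two_of_not_meetsEgg` (`Δ > 0`, `E(ℚ)[2] = 0`, `Ш(W)[2] = 0`, `¬ MeetsEgg W` ⇒ index `2`), `…_eq_two_iff_not_meetsEgg` / `…_eq_one_iff_meetsEgg`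
— so on that slice the clause «index `2` iff `res_∞ Sel₂(W) = 0`» below reads «iff `¬ MeetsEgg W`» (the bit `ε(W)` of DESC-§18);
counts `natCard_selmerGroupRelaxedAtInfinityAtTwo_eq_mul` (`#R = #Sel₂·[R : Sel₂]`), `…_eq_four_of_not_meetsEgg` (rank `1`, `ε = −1`: `#R = 4`),
`…_eq_two_of_meetsEgg` (`ε = +1`: `#R = 2`), `natCard_map_localization_inl_selmerGroupRelaxedAtInfinityAtTwo_eq[_two_of_Δ_pos]` (the image of `R` in
`H¹(ℝ, E[2])` is a LINE at `Δ > 0` — the counting half of DESC-§18-T1; WHICH line is the Poonen–Rains content, not there).  TOWARD DESC-§17-R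
`TwistSelmerEqRelaxedAtInfinityAtTwo` (still a plain `def`, NOT yet a theorem): in the tree are the split-place brick
`Literature.NumberTheory.EllipticCurves.PrimeTwist.selmerLocalKer_eq_of_localChar_eq_one` (gk2-p5 g14, p670078,
`Literature/NumberTheory/EllipticCurves/PrimeTwistLocalConditionSplitPlace.lean`: where `χ` is locally trivial the twist's local condition equals
`W`'s — `v = 2` for `d ≡ 1 (8)`, odd bad `ℓ` with `(d/ℓ) = 1`, good `q` with `(d/q) = 1`; MR 2007 §5 split case) and the two-transposition `iff`
`…GenusKolyTransp.twoTranspositionTwistLaw_iff_strict[_relaxedAtInfinity]` (gk2-p4 g14, p669774, `…TwoTranspositionIff.lean`; Poonen–Rains at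
`T = {∞, v₀, v₁}`); the remaining finite-place bricks (`q ∣ d` with `a_q` odd; inert good `q`) and the ramified-transposition dictionary
«`c ∈ twistCondAbove W χ q ↔ loc_v c = 0`» are announced (gk2-p5 STATUS 21:33:43Z, gk2-p4 INBOX 21:27:20Z).  REF2 (g40, 21:27:41Z): KNOWN-type
IN-PRINT ASSEMBLY ([cite: MazurRubin2010, Lemma 3.2] at `T = {∞}`; [cite: PoonenRains2012, Thm. 4.14, Prop. 4.11]; [cite: KlagsbrunMazurRubin2013, Lemma 5.2]);
kernel-new; beyond-print theorem: no.  PARTITION: none; BSD not proved; no item closed.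

LANDING NOTE (-ty g14, 2026-08-29T00:5xZ; text only, statements untouched): **ALL THREE PLAIN-`def` ROWS OF THIS FILE ARE NOW TREE THEOREMS.**
**DESC-§17-R `TwistSelmerEqRelaxedAtInfinityAtTwo`** is proved by
`Summit.BirchSwinnertonDyer.BirchSwinnertonDyer.Theorems.GenusKolyArch.twistSelmerEqRelaxedAtInfinityAtTwo_holds : TwistSelmerEqRelaxedAtInfinityAtTwo`
(gk2-p5 g14, p673146 ACCEPTED, file `Summits/BirchSwinnertonDyer/BirchSwinnertonDyer/Theorems/GenusKolyvaginAtTwoGenusPrimitiveSupplyAtTwoPrimeTwistInertRat.lean`,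
std axioms): for `W` globally minimal, `d` descent-admissible and `χ` its character, `Sel_𝔓(A_χ) ≤ Sel₂^{rel ∞}(W)` inside `H¹(ℚ, E[2])`, with equality
as soon as `#Sel_𝔓(A_χ) = 2·#Sel₂(W)` — assembled place by place from the one-place dictionary (split places `d ∈ ℚ_v^{×2}`:
`Literature.NumberTheory.EllipticCurves.PrimeTwist.selmerLocalKer_eq_of_localChar_eq_one`, p670078 / p671036; primes `q ∣ d` with `a_q` odd ⇒
`W(ℚ_q)[2] = 0`; inert good `q`: `…GenusKolyArch.primeTwist_selmerLocalKer_eq_of_inert`, p672548, + `primeTwist_selmerLocalKer_le_of_descAdmissible_of_inert`)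
[cite: MazurRubin2010, Def. 3.1, Lemma 3.2, Lemma 2.10] [cite: MazurRubin2007, Def 4.3, Cor 4.6, §5] [cite: Kramer1981, Prop. 7].
**DESC-§17-DICT `TwistModelDictionaryAtTwo`** is proved by `…GenusKolyArch.twistModelDictionaryAtTwo_holds : TwistModelDictionaryAtTwo` (gk2-p5 g15,
p681228 ACCEPTED, file `…/Theorems/GenusKolyvaginAtTwoGenusPrimitiveSupplyAtTwoPrimeTwistModelSelmer.lean` §181, std axioms `propext` / `Classical.choice` /
`Quot.sound` — re-checked by the typer with `lean check --axioms`): all three clauses, every `W`, every square-free `d` (the binders `IsElliptic` and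
`¬ IsSquare d` are unused): (1)(2) from the `G_ℚ`-equivariant `Φ : W^{(d)}(ℚ̄) ≃+ A_χ(ℚ̄)` of file `…PrimeTwistModel.lean` (p680197), transported to `Sel₂` and
`Ш` over ANY number field and ANY model `C • W^{(d)}` (`exists_primeTwistModel_selmerGroup_sha_iff`, `nonempty_selmerGroup_addEquiv_primeTwist_selmerGroup`,
`nonempty_sha_addEquiv_primeTwist_sha`); (3) the θ-bit `shaTwoInTwiceShaFour_iff_not_twistCasselsTateOddAtTwo` (the `H¹` square
`h1Equiv Φ ∘ torsionH1ToH1 = twistShaMapAtTwo ∘ h1Equiv ψ` + the tree's `Sel₂ ↠ Ш[2]` `map_torsionH1ToH1_selmerGroup_holds`). The COUNT every consumer pulls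
through the dictionary is a named theorem: `…GenusKolyArch.natCard_primeTwist_selmerGroup_eq_twistSelmerTwoCard` (`d ≠ 0`, `IsQuadraticCharacterOf χ d` ⇒
`Nat.card (PrimeTwist.selmerGroup W χ) = twistSelmerTwoCard W d`; any model: `natCard_primeTwist_selmerGroup_eq_natCard_selmerGroup_rat`)
[cite: MazurRubin2007, §3, Prop 4.1 and Def 4.3] [cite: SilvermanAEC2009, X.5 Cor. 5.4, Thm X.4.2(a)].
Consumers: feed `(h : TwistModelDictionaryAtTwo)` with `twistModelDictionaryAtTwo_holds`, `(h : TwistSelmerEqRelaxedAtInfinityAtTwo)` with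
`twistSelmerEqRelaxedAtInfinityAtTwo_holds` (and `(h : SelmerIndexInRelaxedAtInfinityAtTwo)` with `…GenusKolyTransp.selmerIndexInRelaxedAtInfinityAtTwo_holds`,
-ty g13 note above). DOWNSTREAM, now kernel too (gk2-p5 g15, p681228 and p681533 / p681961 `…/Theorems/GenusKolyvaginAtTwoGenusPrimitiveSupplyAtTwoPrimeTwistRigidity.lean`,
ns `…GenusKolyArch`, std axioms): U′ `oddBranchShaIndexTwoInTwistSelmerAtTwo_holds` (landing note in `F1Sign2/CasselsTateRadicalAtTwo.lean`); THE UP DECISION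
`primeTwist_selmerGroup_eq_relaxed_of_forall_localization_eq_zero` (`Δ > 0`, `E(ℚ)[2] = 0`, `d` descent-admissible, every `Sel₂(W)`-class trivial at `∞` ⇒
`Sel_𝔓(A_χ) = Sel₂^{rel ∞}(W)` and `#Sel_𝔓(A_χ) = 2·#Sel₂(W)`; T-A `admissibleTwistSelmerShiftAtTwo_holds` in model currency + the dictionary + this row) and the
prime-twist Selmer law BY THE `∞`-BIT `natCard_primeTwist_selmerGroup_eq_of_infinity_bit` (UP `#Sel_𝔓 = 2·#Sel₂` / DOWN `2·#Sel_𝔓 = #Sel₂`); RIGIDITY = THEOREM A(i)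
of MEMO-desc §17 in prime-twist currency `primeTwist_selmerGroup_eq_of_descAdmissible` (`Δ > 0`, `E(ℚ)[2] = 0`: `Sel_𝔓(A_{χ_d}) = Sel_𝔓(A_{χ_d′})` AS SUBGROUPS of
`H¹(ℚ, E[2])` for all descent-admissible `d, d′` — both `Sel₂^{rel ∞}(W)` or both `Sel₂^{str ∞}(W)`, decided by the `∞`-bit:
`primeTwist_selmerGroup_eq_relaxed_or_eq_kummerStrict_decided`); on the odd branch `primeTwist_selmerGroup_eq_relaxed_of_onOddBranch` (`Sel_𝔓(A_χ) = R` for EVERY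
admissible `d`), `natCard_selmerGroupRelaxedAtInfinityAtTwo_eq_eight_of_onOddBranch` (`#R = 8`), `selmerGroup_eq_kummerStrict_of_onOddBranch` (every `Ш(W)[2]`-class
is trivial at `∞`). So the docstring clause of DESC-§17-R below «rigidity T-H / U′ become definitional» is realised in the kernel. REF2 (gk2-p5 g15 placement line,
2026-08-29T00:16:30Z; v16 §35 / v40 above unchanged): KNOWN in print (Mazur–Rubin 2007 §3 «for `p = 2`, `A_L` is the quadratic twist» + Prop 4.1 + Def 4.3;
Kramer 1981 Thm 1 / Prop 7; Mazur–Rubin 2010 Lemma 3.2 / Prop 3.3; Morgan 2023 Lemma 16; Silverman X.5.4, X.4.2(a)); kernel-new; beyond-print theorem: no.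
PARTITION: none; BSD not proved; no item closed; CANDIDATES.md rows DESC-§17-DICT / DESC-§17-R marked «TREE THEOREM».

Planner's module docstring (verbatim):

# Sketch-v10 (planner `-desc` g9, MEMO-desc §17.9): the MODEL ↔ `PrimeTwist` dictionary row (REF1 §41) and the
∞-RELAXED Selmer group = the canonical, `d`-free description of the rigid twisted Selmer group on the up-branch.
Statements only (`def … : Prop`, one definition with body); nothing asserted; no `sorry`.
-/

noncomputable section

open scoped Classical

open WeierstrassCurve Literature.NumberTheory.EllipticCurves NumberField IsDedekindDomain

namespace Summit.BirchSwinnertonDyer.Rank1Residual.F1Sign2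

/-- SUPPORT — the MODEL ↔ `PrimeTwist` DICTIONARY at `p = 2` (REF1-AUDIT §41's recommendation; Mazur–Rubin 2007 §3 /
Prop. 4.1 for `p = 2`; routine but load-bearing for U′ `OddBranchShaIndexTwoInTwistSelmerAtTwo` and B⁰
`OddBranchEggBitEqRadicalBitAtTwo`). For `χ` the quadratic character of `ℚ(√d)/ℚ` (`d` square-free, not a square) the
Mazur–Rubin twist `A_χ` of `W` IS the quadratic twist `W^{(d)}`: `G_ℚ`-equivariantly `A_χ(ℚ̄) ≅ W^{(d)}(ℚ̄)`, restricting to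
the identity on `W[2] = A_χ[𝔓] = W^{(d)}[2]`. Typed as the three consequences the rows use: (1) the `2`-Selmer groups are
isomorphic — hence `Nat.card (PrimeTwist.selmerGroup W χ) = twistSelmerTwoCard W d`, which is what U′ pulls out of
`OnOddBranchAtTwo`; (2) the Tate–Shafarevich groups are isomorphic; (3) the Cassels–Tate parity bit agrees: `θ(W^{(d)}) = +`
(`ShaTwoInTwiceShaFour`, model side) iff the twist's form is not odd (`¬ TwistCasselsTateOddAtTwo`, `PrimeTwist` side) — what B⁰
and DESC-§17-B use. (The Kummer-map and real-component compatibility of `A_χ(ℚ) ≅ W^{(d)}(ℚ)` that B⁰ also uses is part of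
B⁰'s own proof.) [cite: MazurRubin2007, §3 and Prop 4.1] -/
def TwistModelDictionaryAtTwo : Prop :=
  ∀ (W : WeierstrassCurve ℚ) [W.IsElliptic] (d : ℤ) (χ : Field.absoluteGaloisGroup ℚ →ₜ* Multiplicative (ZMod 2)),
    Squarefree d → ¬ IsSquare d → IsQuadraticCharacterOf χ d →
      Nonempty (↥(WeierstrassCurve.selmerGroup (W.quadraticTwist (d : ℚ)) ((2 : ℕ) : ℤ)) ≃+ ↥(PrimeTwist.selmerGroup W χ)) ∧
        Nonempty (↥(WeierstrassCurve.sha (W.quadraticTwist (d : ℚ))) ≃+ ↥(PrimeTwist.sha W χ)) ∧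
          (ShaTwoInTwiceShaFour (W.quadraticTwist (d : ℚ)) ↔ ¬ TwistCasselsTateOddAtTwo W χ)

/-- The ∞-RELAXED `2`-Selmer group `Sel^{rel ∞}_2(W) ⊆ H¹(ℚ, W[2])`: `W`'s local (Kummer) condition at every FINITE place and NO
condition at the real place (Mazur–Rubin 2010 §3, `𝒮^T` with `T = {∞}`). [cite: MazurRubin2010, Def 3.1] -/
def selmerGroupRelaxedAtInfinityAtTwo (W : WeierstrassCurve ℚ) : AddSubgroup (W.galH1Torsion ((2 : ℕ) : ℤ)) :=
  ⨅ v : HeightOneSpectrum (𝓞 ℚ), W.selmerLocalKer (v.adicCompletion ℚ) ((2 : ℕ) : ℤ)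

/-- Typer addition (definitional API, PROVED): `Sel₂(W) ≤ Sel^{rel ∞}_2(W)` — the tree's `WeierstrassCurve.selmerGroup W 2` is the
relaxed group met with the archimedean local conditions, so the inclusion is `inf_le_left`. [folklore] -/
theorem selmerGroup_le_selmerGroupRelaxedAtInfinityAtTwo (W : WeierstrassCurve ℚ) :
    W.selmerGroup ((2 : ℕ) : ℤ) ≤ selmerGroupRelaxedAtInfinityAtTwo W :=
  inf_le_left

/-- Typer addition (definitional API, PROVED): membership in `Sel^{rel ∞}_2(W)` = the finite local conditions only. [folklore] -/
theorem mem_selmerGroupRelaxedAtInfinityAtTwo_iff (W : WeierstrassCurve ℚ) (c : W.galH1Torsion ((2 : ℕ) : ℤ)) :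
    c ∈ selmerGroupRelaxedAtInfinityAtTwo W ↔
      ∀ v : HeightOneSpectrum (𝓞 ℚ), c ∈ W.selmerLocalKer (v.adicCompletion ℚ) ((2 : ℕ) : ℤ) := by
  simp only [selmerGroupRelaxedAtInfinityAtTwo, AddSubgroup.mem_iInf]

/-- Typer addition (definitional API, PROVED): re-imposing the archimedean local conditions on `Sel^{rel ∞}_2(W)` gives back the
tree's `Sel₂(W)` on the nose (`rfl`) — the witness that the definition above relaxes EXACTLY the real place. [folklore] -/
theorem selmerGroupRelaxedAtInfinityAtTwo_inf_infinitePlaces (W : WeierstrassCurve ℚ) :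
    selmerGroupRelaxedAtInfinityAtTwo W ⊓
        (⨅ w : InfinitePlace ℚ, W.selmerLocalKer w.Completion ((2 : ℕ) : ℤ)) = W.selmerGroup ((2 : ℕ) : ℤ) :=
  rfl

/-- SUPPORT (∞-switch lemma, part (a); MR 2010 Lemma 3.2 = Poitou–Tate at `T = {∞}`, the real place being OURS — MR's Prop. 3.3 as
printed lets the real places split): `Sel₂(W) ≤ Sel^{rel ∞}_2(W)` with index `1` or `2` (index `2` iff `Sel₂(W)` is strict at `∞`,
i.e. `res_∞ Sel₂(W) = 0`; for `Δ_W < 0` the index is `1`). [cite: MazurRubin2010, Lemma 3.2] -/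
def SelmerIndexInRelaxedAtInfinityAtTwo : Prop :=
  ∀ (W : WeierstrassCurve ℚ) [W.IsElliptic],
    W.selmerGroup ((2 : ℕ) : ℤ) ≤ selmerGroupRelaxedAtInfinityAtTwo W ∧
      ((W.selmerGroup ((2 : ℕ) : ℤ)).relIndex (selmerGroupRelaxedAtInfinityAtTwo W) = 1 ∨
        (W.selmerGroup ((2 : ℕ) : ℤ)).relIndex (selmerGroupRelaxedAtInfinityAtTwo W) = 2)

/-- SUPPORT / CANONICAL `R` (∞-switch lemma, parts (b)(c); THEOREM CANDIDATE by in-print assembly, MEMO-desc §17.9 (2)): for a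
descent-admissible `d` with character `χ`, the finite local conditions of `W` and `W^{(d)} = A_χ` coincide inside `H¹(ℚ, W[2])`
(`d ∈ ℚ_v^{×2}` at `v ∣ 2N`, `H¹(ℚ_q, W[2]) = 0` at `q ∣ d` since `a_q` is odd), so `Sel₂(W^χ) ≤ Sel^{rel ∞}_2(W)`; if moreover the
twist GAINS Selmer rank (`#Sel₂(W^χ) = 2·#Sel₂(W)`: the up-branch, e.g. every admissible twist on `OnOddBranchAtTwo`, and every
admissible twist of a curve with `W(ℚ) ⊂ W⁰(ℝ)` and `Ш(W)[2] = 0`), then `Sel₂(W^χ)` IS the ∞-relaxed Selmer group of `W` — a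
description in which `d` does not occur (rigidity T-H / U′ become definitional; the Cassels–Tate forms of the whole admissible
family live on this one group). Which branch a given `W` is on is decided by `res_∞ Sel₂(W)` (up iff it vanishes); when
`Ш(W)[2] = 0` and `W(ℚ) ⊂ W⁰(ℝ)` the up-branch is automatic, when `Ш(W)[2] ≠ 0` it is RARE (planner census D18e–D18g, kit
j294681/j294796/j295013, ALL 15 382 rank-0 / odd-torsion / `Δ > 0` / `dim Ш[2] = 2` curves of Cremona's table: up on 513 = 3.34 % —
`#Ш_an = 4`: 485/13 993, `16`: 23/1 095 (exactly the `#Ш_an = 16` members of the cell's odd-branch list), `36`: 3/194, `≥ 64`: 2/102;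
0.66 % for `N < 5·10⁴` rising to a 3–4.7 % plateau; rank 1 with `Ш[2] = (ℤ/2)²`, `P ∈ W⁰(ℝ)`: 0/265), matching the cell's F1 census
`ε = −1` on 3.2 % (MEMO-desc §8) and far below the structureless 25 %.
[cite: MazurRubin2010, Lemma 3.2 and Prop 3.3] [cite: Morgan2023KummerGeneric, Lemma 16] -/
def TwistSelmerEqRelaxedAtInfinityAtTwo : Prop :=
  ∀ (W : WeierstrassCurve ℚ) [W.IsElliptic] [W.IsGloballyMinimal] (d : ℤ)
    (χ : Field.absoluteGaloisGroup ℚ →ₜ* Multiplicative (ZMod 2)), DescAdmissible W d → IsQuadraticCharacterOf χ d →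
      PrimeTwist.selmerGroup W χ ≤ selmerGroupRelaxedAtInfinityAtTwo W ∧
        (Nat.card (PrimeTwist.selmerGroup W χ) = 2 * selmerTwoCard W →
          PrimeTwist.selmerGroup W χ = selmerGroupRelaxedAtInfinityAtTwo W)

/-- Proved glue: the canonical-`R` row implies U′ on the odd branch GIVEN the dictionary's cardinality transfer
(`#PrimeTwist.selmerGroup W χ = twistSelmerTwoCard W d = 8 = 2·4`) and part (a). Recorded as the implication actually used. -/
theorem shaIndexTwo_of_relaxed (W : WeierstrassCurve ℚ) [W.IsElliptic]
    (χ : Field.absoluteGaloisGroup ℚ →ₜ* Multiplicative (ZMod 2))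
    (hR : PrimeTwist.selmerGroup W χ = selmerGroupRelaxedAtInfinityAtTwo W)
    (hle : W.selmerGroup ((2 : ℕ) : ℤ) ≤ selmerGroupRelaxedAtInfinityAtTwo W)
    (hidx : (W.selmerGroup ((2 : ℕ) : ℤ)).relIndex (selmerGroupRelaxedAtInfinityAtTwo W) = 2) :
    W.selmerGroup ((2 : ℕ) : ℤ) ≤ PrimeTwist.selmerGroup W χ ∧
      (W.selmerGroup ((2 : ℕ) : ℤ)).relIndex (PrimeTwist.selmerGroup W χ) = 2 := by
  rw [hR]; exact ⟨hle, hidx⟩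

end Summit.BirchSwinnertonDyer.Rank1Residual.F1Sign2

end
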